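import Summits.QuantumFields.YangMills.Theorems.UnitScaleTiltHalvingOmegaRowMemberS
import HarnessLib

/-!
# Line H (`BirthV10.stub_halvingStep`, stmt-QuantumFields-19200) — (B-al-4)₃'s ω-ROW (F-ω), NUMERICS-S (σ-EDITION) — NUMERICS of the σ-guarded closed form: `0 ≤ ω_j^σ ≤ 1∕600` under the
# L-only `ε₀`-window `10⁹·L·ε₀ ≤ 1` and the σ-window `0 ≤ cσ`, `8·3800((d+2)L)²·cσ ≤ 1` (d = 3, `L ≥ 3` odd, `j < K − n`); the `if`-guarded letter `ω j := if j < K − n then ω_j^σ else 0`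

Cell `ym3-torus` (HUMAN RULING D-0037: YM₃ on T³ is ladder rung R3 — NOT d = 4, NOT infinite volume, NOT a mass gap, NOT the Clay problem), width seat `ym3-torus-px9` gen 6.
`--supports stmt-QuantumFields-19200 --as helper`; THEOREMS ONLY (0 `def`, 0 `sorry`); count-neutral; pure real arithmetic and one `if_pos` — nothing here claims (B-al-4)₃, the
(b)-row, the stub, the crux or the gap.

WHAT (namespace `…Theorems.HalvingOmegaRowNumericsS`): ★ `omega_window_σ` — for the literal right-hand side `ω_j^σ` of ✓`HalvingOmegaRowMemberS.omegaRow_of_guards_σ`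
(a function of `(F, K, n, ε₀, cσ, j)`): `0 ≤ ω_j^σ ≤ 1∕600` whenever `0 ≤ ε₀`, `10⁹·L·ε₀ ≤ 1`, `0 ≤ cσ`, `8·3800((d+2)L)²·cσ ≤ 1`, `j < K − n` (sizes: `a_j = 192·Lʲη·cσ ≤ 64cσ ≤ 1∕1500`,
`x_j ≤ 43008·Lε₀ + 3cσ ≤ 10⁻⁴`); `omega_if_window_σ` — the same for `if j < K − n then ω_j^σ else 0`, every `j`; ★★★ `omegaRow_of_guards_σ_if` — ✓`omegaRow_of_guards_σ`
concluding with the `if`-letter (inside the row `j < K − n`).  At the consumer's `cσ = 2L·c⋆ = 30L²B₀(ε₀ + α₁)` both σ-windows follow from the v10 prefix window.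
[cite: Balaban1985Averaging, Prop. 2 (54) p.26, (84) p.30, (163) p.42; Balaban1985RegularSpaces, (1.29) p.81, (1.42) p.83]
-/

set_option autoImplicit false

noncomputable section

open scoped BigOperators Matrix.Norms.L2Operator

namespace Summit.QuantumFields.YangMills.Theorems.HalvingOmegaRowNumericsS

open Literature.MathematicalPhysics.QuantumFieldTheory.Balaban1983to89
open Literature.MathematicalPhysics.QuantumFieldTheory.Balaban1983to89.T3ContinuumYM3Torus
open HalvingOmegaRowMember (omegaForm_mono)
open HalvingOmegaRowMemberS (omegaRow_of_guards_σ)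
open B7Prop1Explicit renaming Site → LSite
open B7Prop1Explicit (e boxVec)
open B7Prop1Local (InBox)
open B7Prop2Explicit (avgIter C0 c2')
open B7Eq92Concrete (mgauge)
open B7Eq84Concrete (uavg)
open B8Ineq130 (tlo thi)
open B8Ineq132 (InAk)
open B8Eq119TwistedAxial (InAx Restr129)
open B8Eq131Cubes (cube sqLo sqHi tLo tHi)
open B8Eq184Proof (cfgExp)
open B8CubeMemberZd (cubeLamS)
open B8Lemma1NonAbelian (lowPart)
open B10Eq27TorusAxialLog (pull unitsField toUField)

variable (F : T3Family) {n K : ℕ}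

set_option maxHeartbeats 400000 in
/-- ★ **THE NUMERIC ROWS `hω0`, `hω1` FOR THE σ-GUARDED CLOSED FORM `ω_j^σ`**: `0 ≤ ω_j^σ ≤ 1∕600` under `0 ≤ ε₀`, `10⁹·L·ε₀ ≤ 1`, `0 ≤ cσ`, `8·3800((d+2)L)²·cσ ≤ 1`, `j < K − n`
(d = 3, `L ≥ 3`). [cite: Balaban1985Averaging, Prop. 2 (54) p.26, (163) p.42; Balaban1985RegularSpaces, (1.29) p.81, (1.42) p.83] -/
theorem omega_window_σ {ε₀ : ℝ} (hε₀ : 0 ≤ ε₀) (hε : 10 ^ 9 * (F.L : ℝ) * ε₀ ≤ 1) {cσ : ℝ} (hσ0 : 0 ≤ cσ) (hσ : 8 * 3800 * ((((F.P K).d + 2) * (F.P K).L : ℕ) : ℝ) ^ 2 * cσ ≤ 1)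
    {j : ℕ} (hj : j < K - n) :
    0 ≤
      (((F.P K).d : ℝ) * (((F.P K).L : ℝ) - 1)) * (256 * (((F.P K).d : ℝ) + 1) * (((F.P K).d : ℝ) + 4) * (2 * ε₀) * (((F.P K).L : ℝ) ^ j * (((F.P K).L : ℝ) ^ (K - n))⁻¹) ^ 2 +
          ((F.P K).L : ℝ) ^ j * (((F.L : ℝ)⁻¹) ^ (K - n) * cσ))
        + 2 * (64 * ((F.P K).d : ℝ) * (((F.P K).L : ℝ) ^ j * (((F.L : ℝ)⁻¹) ^ (K - n) * cσ)))
        + (64 * ((F.P K).d : ℝ) * (((F.P K).L : ℝ) ^ j * (((F.L : ℝ)⁻¹) ^ (K - n) * cσ))) ^ 2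
        + (2 * (64 * ((F.P K).d : ℝ) * (((F.P K).L : ℝ) ^ j * (((F.L : ℝ)⁻¹) ^ (K - n) * cσ))) +
            (64 * ((F.P K).d : ℝ) * (((F.P K).L : ℝ) ^ j * (((F.L : ℝ)⁻¹) ^ (K - n) * cσ))) ^ 2) *
          ((((F.P K).d : ℝ) * (((F.P K).L : ℝ) - 1)) * (256 * (((F.P K).d : ℝ) + 1) * (((F.P K).d : ℝ) + 4) * (2 * ε₀) * (((F.P K).L : ℝ) ^ j * (((F.P K).L : ℝ) ^ (K - n))⁻¹) ^ 2 +
            ((F.P K).L : ℝ) ^ j * (((F.L : ℝ)⁻¹) ^ (K - n) * cσ))) ∧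
    (((F.P K).d : ℝ) * (((F.P K).L : ℝ) - 1)) * (256 * (((F.P K).d : ℝ) + 1) * (((F.P K).d : ℝ) + 4) * (2 * ε₀) * (((F.P K).L : ℝ) ^ j * (((F.P K).L : ℝ) ^ (K - n))⁻¹) ^ 2 +
        ((F.P K).L : ℝ) ^ j * (((F.L : ℝ)⁻¹) ^ (K - n) * cσ))
      + 2 * (64 * ((F.P K).d : ℝ) * (((F.P K).L : ℝ) ^ j * (((F.L : ℝ)⁻¹) ^ (K - n) * cσ)))
      + (64 * ((F.P K).d : ℝ) * (((F.P K).L : ℝ) ^ j * (((F.L : ℝ)⁻¹) ^ (K - n) * cσ))) ^ 2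
      + (2 * (64 * ((F.P K).d : ℝ) * (((F.P K).L : ℝ) ^ j * (((F.L : ℝ)⁻¹) ^ (K - n) * cσ))) +
          (64 * ((F.P K).d : ℝ) * (((F.P K).L : ℝ) ^ j * (((F.L : ℝ)⁻¹) ^ (K - n) * cσ))) ^ 2) *
        ((((F.P K).d : ℝ) * (((F.P K).L : ℝ) - 1)) * (256 * (((F.P K).d : ℝ) + 1) * (((F.P K).d : ℝ) + 4) * (2 * ε₀) * (((F.P K).L : ℝ) ^ j * (((F.P K).L : ℝ) ^ (K - n))⁻¹) ^ 2 +
          ((F.P K).L : ℝ) ^ j * (((F.L : ℝ)⁻¹) ^ (K - n) * cσ))) ≤ 1 / 600 := by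
  -- letters
  have hFL : ((F.P K).L : ℝ) = (F.L : ℝ) := rfl
  have hL2 : 2 ≤ (F.P K).L := (F.P K).hL.2
  have hL3 : 3 ≤ (F.P K).L := by have hodd : Odd (F.P K).L := F.hL.1; obtain ⟨t, ht⟩ := hodd; omega
  have hLr3 : (3 : ℝ) ≤ ((F.P K).L : ℝ) := by exact_mod_cast hL3
  have hLr0 : (0 : ℝ) < ((F.P K).L : ℝ) := by linarith
  have hdr : ((F.P K).d : ℝ) = 3 := by rw [T3Family.P_d F K]; norm_num
  have hcast : ((((F.P K).d + 2) * (F.P K).L : ℕ) : ℝ) = 5 * ((F.P K).L : ℝ) := by push_cast; rw [hdr]; ring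
  -- the outer σ-window gives `10⁵·cσ ≤ 760000·L²·cσ ≤ 1`
  have hσ5 : 10 ^ 5 * cσ ≤ 1 := by
    rw [hcast] at hσ
    have h9 : (9 : ℝ) ≤ ((F.P K).L : ℝ) ^ 2 := by nlinarith
    have h1 : 10 ^ 5 * cσ ≤ 8 * 3800 * (5 * ((F.P K).L : ℝ)) ^ 2 * cσ := by nlinarith
    exact h1.trans hσ
  rw [← hFL] at hε ⊢
  rw [hdr]
  set Lr : ℝ := ((F.P K).L : ℝ) with hLrdef
  set k : ℕ := K - n with hk
  -- the two small quantities `Q = (Lʲ∕Lᵏ)² ≤ 1`, `S = Lʲη·cσ ≤ cσ∕L`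
  set Q : ℝ := (Lr ^ j * (Lr ^ k)⁻¹) ^ 2 with hQ
  set S : ℝ := Lr ^ j * ((Lr⁻¹) ^ k * cσ) with hS
  have hQ0 : 0 ≤ Q := by positivity
  have hS0 : 0 ≤ S := by positivity
  have hjk : j + 1 ≤ k := hj
  have hq1 : Lr ^ j * (Lr ^ k)⁻¹ ≤ 1 := by
    rw [← div_eq_mul_inv, div_le_one (by positivity)]
    exact pow_le_pow_right₀ (by linarith) (by omega)
  have hQ1 : Q ≤ 1 := by rw [hQ]; exact pow_le_one₀ (by positivity) hq1
  have hLjη : Lr ^ j * (Lr⁻¹) ^ k * Lr ≤ 1 := by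
    rw [inv_pow]
    have h2 : Lr ^ (j + 1) ≤ Lr ^ k := pow_le_pow_right₀ (by linarith) hjk
    calc Lr ^ j * (Lr ^ k)⁻¹ * Lr = Lr ^ (j + 1) * (Lr ^ k)⁻¹ := by ring
      _ ≤ Lr ^ k * (Lr ^ k)⁻¹ := mul_le_mul_of_nonneg_right h2 (by positivity)
      _ = 1 := mul_inv_cancel₀ (by positivity)
  have hSL : S * Lr ≤ cσ := by
    have e : S * Lr = (Lr ^ j * (Lr⁻¹) ^ k * Lr) * cσ := by rw [hS]; ring
    rw [e]
    calc _ ≤ 1 * cσ := mul_le_mul_of_nonneg_right hLjη hσ0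
      _ = cσ := one_mul _
  have hS3 : S * 3 ≤ cσ := (mul_le_mul_of_nonneg_left hLr3 hS0).trans hSL
  -- `x ≤ 3L·(14336ε₀·Q + S) ≤ 43008·Lε₀ + 3·(S·L) ≤ 10⁻⁴`, `a = 192·S ≤ 64cσ ≤ 1∕1500`
  set x : ℝ := 3 * (Lr - 1) * (256 * (3 + 1) * (3 + 4) * (2 * ε₀) * Q + S) with hx
  set a : ℝ := 64 * 3 * S with ha
  have hD0 : 0 ≤ 3 * (Lr - 1) := by linarith
  have hx0 : 0 ≤ x := by rw [hx]; exact mul_nonneg hD0 (by positivity)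
  have ha0 : 0 ≤ a := by rw [ha]; positivity
  have hLε : Lr * ε₀ ≤ 1 / 10 ^ 9 := by rw [le_div_iff₀ (by norm_num)]; linarith
  have hxle : x ≤ 1 / 10000 := by
    rw [hx]
    have h1 : 256 * (3 + 1) * (3 + 4) * (2 * ε₀) * Q + S ≤ 14336 * ε₀ + S := by nlinarith
    have h2 : 3 * (Lr - 1) * (256 * (3 + 1) * (3 + 4) * (2 * ε₀) * Q + S) ≤ 3 * Lr * (14336 * ε₀ + S) := by
      calc _ ≤ 3 * (Lr - 1) * (14336 * ε₀ + S) := mul_le_mul_of_nonneg_left h1 hD0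
        _ ≤ 3 * Lr * (14336 * ε₀ + S) := mul_le_mul_of_nonneg_right (by linarith) (by positivity)
    have h3 : 3 * Lr * (14336 * ε₀ + S) = 43008 * (Lr * ε₀) + 3 * (S * Lr) := by ring
    rw [h3] at h2
    linarith
  have hale : a ≤ 1 / 1500 := by rw [ha]; linarith
  refine ⟨by positivity, ?_⟩
  calc _ = x + 2 * a + a ^ 2 + (2 * a + a ^ 2) * x := by rw [hx, ha]
    _ ≤ 1 / 10000 + 2 * (1 / 1500) + (1 / 1500) ^ 2 + (2 * (1 / 1500) + (1 / 1500) ^ 2) * (1 / 10000) := omegaForm_mono hx0 ha0 hxle hale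
    _ ≤ 1 / 600 := by norm_num

/-- The same window for the `if`-GUARDED letter `ω j := if j < K − n then ω_j^σ else 0` — the shape the core quantifies (`∀ j`, no guard). [cite: Balaban1985Averaging, Prop. 2 (54)
p.26, (163) p.42] -/
theorem omega_if_window_σ {ε₀ : ℝ} (hε₀ : 0 ≤ ε₀) (hε : 10 ^ 9 * (F.L : ℝ) * ε₀ ≤ 1) {cσ : ℝ} (hσ0 : 0 ≤ cσ) (hσ : 8 * 3800 * ((((F.P K).d + 2) * (F.P K).L : ℕ) : ℝ) ^ 2 * cσ ≤ 1) (j : ℕ) :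
    0 ≤ (if j < K - n then
      (((F.P K).d : ℝ) * (((F.P K).L : ℝ) - 1)) * (256 * (((F.P K).d : ℝ) + 1) * (((F.P K).d : ℝ) + 4) * (2 * ε₀) * (((F.P K).L : ℝ) ^ j * (((F.P K).L : ℝ) ^ (K - n))⁻¹) ^ 2 +
          ((F.P K).L : ℝ) ^ j * (((F.L : ℝ)⁻¹) ^ (K - n) * cσ))
        + 2 * (64 * ((F.P K).d : ℝ) * (((F.P K).L : ℝ) ^ j * (((F.L : ℝ)⁻¹) ^ (K - n) * cσ)))
        + (64 * ((F.P K).d : ℝ) * (((F.P K).L : ℝ) ^ j * (((F.L : ℝ)⁻¹) ^ (K - n) * cσ))) ^ 2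
        + (2 * (64 * ((F.P K).d : ℝ) * (((F.P K).L : ℝ) ^ j * (((F.L : ℝ)⁻¹) ^ (K - n) * cσ))) +
            (64 * ((F.P K).d : ℝ) * (((F.P K).L : ℝ) ^ j * (((F.L : ℝ)⁻¹) ^ (K - n) * cσ))) ^ 2) *
          ((((F.P K).d : ℝ) * (((F.P K).L : ℝ) - 1)) * (256 * (((F.P K).d : ℝ) + 1) * (((F.P K).d : ℝ) + 4) * (2 * ε₀) * (((F.P K).L : ℝ) ^ j * (((F.P K).L : ℝ) ^ (K - n))⁻¹) ^ 2 +
            ((F.P K).L : ℝ) ^ j * (((F.L : ℝ)⁻¹) ^ (K - n) * cσ)))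
      else (0 : ℝ)) ∧
    (if j < K - n then
      (((F.P K).d : ℝ) * (((F.P K).L : ℝ) - 1)) * (256 * (((F.P K).d : ℝ) + 1) * (((F.P K).d : ℝ) + 4) * (2 * ε₀) * (((F.P K).L : ℝ) ^ j * (((F.P K).L : ℝ) ^ (K - n))⁻¹) ^ 2 +
          ((F.P K).L : ℝ) ^ j * (((F.L : ℝ)⁻¹) ^ (K - n) * cσ))
        + 2 * (64 * ((F.P K).d : ℝ) * (((F.P K).L : ℝ) ^ j * (((F.L : ℝ)⁻¹) ^ (K - n) * cσ)))
        + (64 * ((F.P K).d : ℝ) * (((F.P K).L : ℝ) ^ j * (((F.L : ℝ)⁻¹) ^ (K - n) * cσ))) ^ 2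
        + (2 * (64 * ((F.P K).d : ℝ) * (((F.P K).L : ℝ) ^ j * (((F.L : ℝ)⁻¹) ^ (K - n) * cσ))) +
            (64 * ((F.P K).d : ℝ) * (((F.P K).L : ℝ) ^ j * (((F.L : ℝ)⁻¹) ^ (K - n) * cσ))) ^ 2) *
          ((((F.P K).d : ℝ) * (((F.P K).L : ℝ) - 1)) * (256 * (((F.P K).d : ℝ) + 1) * (((F.P K).d : ℝ) + 4) * (2 * ε₀) * (((F.P K).L : ℝ) ^ j * (((F.P K).L : ℝ) ^ (K - n))⁻¹) ^ 2 +
            ((F.P K).L : ℝ) ^ j * (((F.L : ℝ)⁻¹) ^ (K - n) * cσ)))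
      else (0 : ℝ)) ≤ 1 / 600 := by
  split_ifs with hj
  · exact omega_window_σ F hε₀ hε hσ0 hσ hj
  · norm_num

set_option maxHeartbeats 400000 in
/-- ★★★ ✓`omegaRow_of_guards_σ` RESTATED WITH THE `if`-GUARDED LETTER `ω j := if j < K − n then ω_j^σ else 0` (inside the row `j < K − n`, so the `if` is its first branch) —
with `omega_if_window_σ` the core's three arguments `hω0 hω1 hOsc` are `exact`s. [cite: Balaban1985Averaging, (84) p.30, (163) p.42; Balaban1985RegularSpaces, (1.29) p.81,
(1.42) p.83] -/
theorem omegaRow_of_guards_σ_if {ε₀ : ℝ} (hε₀ : 0 < ε₀)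
    (hα3 : C0 (F.P K).d * (2 * ε₀) ≤ 1 / 3) (hα2 : 2 * (2 * ε₀) ≤ c2' (F.P K).d (F.P K).L)
    {αω : ℝ} (hαω : 0 < αω) (hαω3 : C0 (F.P K).d * αω ≤ 1 / 3) (hαω4 : 4 * αω ≤ c2' (F.P K).d (F.P K).L)
    (hαωexp : Real.exp (4 * (800 * (((F.P K).d : ℝ) + 1) ^ 2 * (((F.P K).d : ℝ) + 4)) * αω) ≤ 11 / 10)
    (a : LSite (F.P K).d) (M' ρ' : ℕ) (s cσ : ℝ) (U : GaugeField (F.P K) 0 (Matrix.specialUnitaryGroup (Fin 2) ℂ)) :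
    ∀ (gJ : GaugeTransf (F.P K) 0 (Matrix.specialUnitaryGroup (Fin 2) ℂ)) (u₁ : LSite (F.P K).d → (Matrix (Fin 2) (Fin 2) ℂ)ˣ)
        (W : LSite (F.P K).d → Fin (F.P K).d → (Matrix (Fin 2) (Fin 2) ℂ)ˣ) (A : LSite (F.P K).d → Fin (F.P K).d → Matrix (Fin 2) (Fin 2) ℂ) (c₁ c' : ℝ),
      InAk (F.P K).L (K - n) (((F.L : ℝ)⁻¹) ^ (K - n)) ε₀ (fun _ => (Set.univ : Set (LSite (F.P K).d))) (pull (unitsField (toUField (GaugeField.gaugeAct gJ U))) 0) →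
      (∀ m', m' ≤ K - n → ∀ Λ : ℕ → Set (LSite (F.P K).d), InAx (F.P K).L m' Λ (1 : LSite (F.P K).d → Fin (F.P K).d → (Matrix (Fin 2) (Fin 2) ℂ)ˣ) (pull (unitsField (toUField (GaugeField.gaugeAct gJ U))) 0)) →
      (∀ m', m' ≤ K - n → ∀ (x : LSite (F.P K).d) (ν : Fin (F.P K).d), tlo (F.P K).L (tLo a ρ') m' ≤ x → x + e ν ≤ thi (F.P K).L (tHi a M' ρ') m' →
        ‖((avgIter (F.P K).L (pull (unitsField (toUField (GaugeField.gaugeAct gJ U))) 0) (K - n - m') x ν : (Matrix (Fin 2) (Fin 2) ℂ)ˣ) : Matrix (Fin 2) (Fin 2) ℂ) - 1‖ < s) →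
      (∀ (x : LSite (F.P K).d) (ν : Fin (F.P K).d), tLo a ρ' ≤ x → x + e ν ≤ tHi a M' ρ' → lowPart ν (x - tLo a ρ') = 0 →
        avgIter (F.P K).L (pull (unitsField (toUField (GaugeField.gaugeAct gJ U))) 0) (K - n) x ν = 1) →
      (∀ z, ((u₁ z : (Matrix (Fin 2) (Fin 2) ℂ)ˣ) : Matrix (Fin 2) (Fin 2) ℂ) ∈ Matrix.specialUnitaryGroup (Fin 2) ℂ) →
      mgauge (1 : LSite (F.P K).d → Fin (F.P K).d → (Matrix (Fin 2) (Fin 2) ℂ)ˣ) u₁ W = pull (unitsField (toUField (GaugeField.gaugeAct gJ U))) 0 →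
      0 ≤ c' → 8 * 3800 * ((((F.P K).d + 2) * (F.P K).L : ℕ) : ℝ) ^ 2 * c' ≤ 1 → c' ≤ cσ → Real.exp c₁ - 1 ≤ ((F.L : ℝ)⁻¹) ^ (K - n) * c' →
      (∀ z ∈ cube (F.P K).L a M' ρ' (K - n) (K - n), ∀ ν : Fin (F.P K).d, W z ν = cfgExp (((F.L : ℝ)⁻¹) ^ (K - n)) A z ν ∧ ((F.L : ℝ)⁻¹) ^ (K - n) * ‖A z ν‖ ≤ c₁) →
      Restr129 (F.P K).L (K - n) (cubeLamS (F.P K).L a M' ρ' (K - n) (K - n)) (1 : LSite (F.P K).d → Fin (F.P K).d → (Matrix (Fin 2) (Fin 2) ℂ)ˣ) u₁ →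
      ∀ j, j < K - n → ∀ c : LSite (F.P K).d,
        InBox (tlo (F.P K).L (sqLo (F.P K).L a ρ' (K - n) (K - n)) (K - n - (j + 1))) (thi (F.P K).L (sqHi (F.P K).L a M' ρ' (K - n) (K - n)) (K - n - (j + 1))) c →
        ∀ r : Fin (F.P K).d → Fin (F.P K).L,
          ‖((((uavg (F.P K).L (1 : LSite (F.P K).d → Fin (F.P K).d → (Matrix (Fin 2) (Fin 2) ℂ)ˣ) u₁ j (((F.P K).L : ℤ) • c))⁻¹ *
              uavg (F.P K).L (1 : LSite (F.P K).d → Fin (F.P K).d → (Matrix (Fin 2) (Fin 2) ℂ)ˣ) u₁ j (((F.P K).L : ℤ) • c + boxVec (F.P K).L r)) :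
            (Matrix (Fin 2) (Fin 2) ℂ)ˣ) : Matrix (Fin 2) (Fin 2) ℂ) - 1‖ ≤
            (if j < K - n then
      (((F.P K).d : ℝ) * (((F.P K).L : ℝ) - 1)) * (256 * (((F.P K).d : ℝ) + 1) * (((F.P K).d : ℝ) + 4) * (2 * ε₀) * (((F.P K).L : ℝ) ^ j * (((F.P K).L : ℝ) ^ (K - n))⁻¹) ^ 2 +
          ((F.P K).L : ℝ) ^ j * (((F.L : ℝ)⁻¹) ^ (K - n) * cσ))
        + 2 * (64 * ((F.P K).d : ℝ) * (((F.P K).L : ℝ) ^ j * (((F.L : ℝ)⁻¹) ^ (K - n) * cσ)))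
        + (64 * ((F.P K).d : ℝ) * (((F.P K).L : ℝ) ^ j * (((F.L : ℝ)⁻¹) ^ (K - n) * cσ))) ^ 2
        + (2 * (64 * ((F.P K).d : ℝ) * (((F.P K).L : ℝ) ^ j * (((F.L : ℝ)⁻¹) ^ (K - n) * cσ))) +
            (64 * ((F.P K).d : ℝ) * (((F.P K).L : ℝ) ^ j * (((F.L : ℝ)⁻¹) ^ (K - n) * cσ))) ^ 2) *
          ((((F.P K).d : ℝ) * (((F.P K).L : ℝ) - 1)) * (256 * (((F.P K).d : ℝ) + 1) * (((F.P K).d : ℝ) + 4) * (2 * ε₀) * (((F.P K).L : ℝ) ^ j * (((F.P K).L : ℝ) ^ (K - n))⁻¹) ^ 2 +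
            ((F.P K).L : ℝ) ^ j * (((F.L : ℝ)⁻¹) ^ (K - n) * cσ)))
      else (0 : ℝ)) := by
  intro gJ u₁ W A c₁ c' hInAk hInAx htow htop hu₁ hR1m hc' h3800 hcσ hexp hcube h129 j hj c hc r
  rw [if_pos hj]
  exact omegaRow_of_guards_σ F hε₀ hα3 hα2 hαω hαω3 hαω4 hαωexp a M' ρ' s cσ U gJ u₁ W A c₁ c' hInAk hInAx htow htop hu₁ hR1m hc' h3800 hcσ hexp hcube h129 j hj
    c hc r

end Summit.QuantumFields.YangMills.Theorems.HalvingOmegaRowNumericsS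

end
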